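import Summits.CriticalPhenomena.PercolationContinuityZ3.Theorems.PercNearOneGluingNoHeavyLowerTailSahiE3PatternCertificate
import Literature.Probability.LatticeModels.StrassenHolleyCoupling
import Mathlib.Tactic.Linarith
import Mathlib.Tactic.Ring
import Mathlib.Tactic.Positivity
import HarnessLib
import HarnessLib.Audit

/-!
# `NoHeavyLowerTail` (crux stmt-CriticalPhenomena-4575), Sahi programme P4 (Holley / monotone coupling):
# the FLOW-FREE ("sandwich") form of a flow certificate

Support file (cell `prim-l12`, seat P4, generation 18; `--supports stmt-CriticalPhenomena-4575`).  No named facts, no sorries;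
standard axioms; def-free.

A flow certificate for a slot `U` of a finite pattern `P` with fibre masses `ν`
(`…SahiE3PatternCertificate.phi_nonneg_of_patternCertificate`: data `R` on `U` and flows `F` from `U` down to `Uᶜ` with
(R0), (F0), (F≤), (cap), (K), (pair)) carries `|U|·|Uᶜ|` flow variables.  THEOREM `exists_certificate_of_sandwich`: the flows
are redundant — a certificate exists as soon as there is ONE function `R ≥ 0` on `P` with (`Z = Σ ν`, `N_U = Σ_U ν`, `N_D = Σ_{Uᶜ} ν`)

  (L)  `Z·(N(S)·N_U(S') + N(S')·N_U(S)) − N_U·N(S)·N(S') ≤ Σ_{t ∈ S ∩ S'} R t`        for all up-sets `S, S'`,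
  (C)  `Σ_{t ∈ W} R t + Z·N_U·Σ_{s ∈ W ∩ Uᶜ} ν s ≤ Z·(Z + N_D)·Σ_{t ∈ W ∩ U} ν t`          for all up-sets `W`

(`ν ≥ 0`).  Conversely (`sandwich_of_certificate`) every flow certificate gives such an `R` (retained mass on `U`, excess
delivery `K` on `Uᶜ`), so the two notions are EQUIVALENT; `phi_nonneg_of_sandwich` and `latticeE3_nonneg_of_sandwich` are the
flow-free versions of the two theorems of `…SahiE3PatternCertificate`.

PROOF.  (L) at `S = S' = univ` and (C) at `W = univ` force `Σ R = Z²·N_U`, so the weights `μ₁ = R + Z·N_U·ν·1_{Uᶜ}` and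
`μ₂ = Z(Z+N_D)·ν·1_U` have equal mass and (C) says `μ₁(W) ≤ μ₂(W)` on up-sets; Strassen's theorem on the finite poset
(`Literature.Probability.LatticeModels.exists_monotoneCoupling_of_upperSets_le`) gives a coupling `π(y, x)` supported on `y ≤ x`.
Reading `π` downwards — `x ∈ U` keeps `R' x = Σ_{y ∈ U} π(y,x)` and sends `F x s = π(s,x)` to each `s ∉ U` — is a flow certificate:
(cap) with equality, deliveries `Σ_t F t s = μ₁ s ≥ Z·N_U·ν s`, and on an up-set `W` the retained mass `Σ_{W∩U} R'` dominates
`Σ_{W∩U} R` because mass entering `y ∈ W` comes from `x ≥ y`, `x ∈ W`; so (pair) follows from (L).  Normalised (`Z = 1`,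
`u = N_U`, `d = N_D`): (L) `R(S∩S') ≥ π(S)π_U(S') + π(S')π_U(S) − u·π(S)π(S')`, (C) `R(W) + u·π(W∖U) ≤ (1+d)·π(W∩U)` — the existence
of a certificate is a linear SANDWICH problem in `|P|` variables (HOME prim-l12-p4, gen 18 memo), which is what the census code uses.
-/

namespace Summit.CriticalPhenomena.PercolationContinuityZ3.Theorems.SahiE3CertSandwich

open Finset Literature.Combinatorics.Sahi2008 Literature.Probability.LatticeModels
open scoped BigOperators

variable {P : Type*} [Fintype P] [DecidableEq P] [PartialOrder P]

omit [PartialOrder P] in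
/-- `Σ_{t ∈ W} f = Σ_{t ∈ W ∩ U} f + Σ_{t ∈ W ∩ Uᶜ} f`. [folklore] -/
theorem sum_split (W U : Finset P) (f : P → ℝ) :
    ∑ t ∈ W, f t = ∑ t ∈ W ∩ U, f t + ∑ t ∈ W ∩ Uᶜ, f t := by
  rw [← Finset.sdiff_eq_inter_compl, Finset.sum_inter_add_sum_sdiff]

/-- **Flow-free form ⟹ flow certificate.**  `ν ≥ 0` fibre masses on a finite poset `P`, `U ⊆ P` the slot, `R ≥ 0` on `P`
with (L) and (C) of the module docstring.  Then there are `R'` and flows `F` satisfying the six hypotheses (R0), (F0), (F≤),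
(cap), (K), (pair) of `…SahiE3PatternCertificate.phi_nonneg_of_patternCertificate` (Strassen's theorem on `P`). [this work] -/
theorem exists_certificate_of_sandwich (U : Finset P) (ν R : P → ℝ) (hν : ∀ t, 0 ≤ ν t) (hR : ∀ t, 0 ≤ R t)
    (hL : ∀ S S' : Finset P, IsUpperSet (S : Set P) → IsUpperSet (S' : Set P) →
      (∑ r, ν r) * ((∑ t ∈ S, ν t) * (∑ t ∈ S' ∩ U, ν t) + (∑ t ∈ S', ν t) * (∑ t ∈ S ∩ U, ν t))
          - (∑ r ∈ U, ν r) * (∑ t ∈ S, ν t) * (∑ t ∈ S', ν t) ≤ ∑ t ∈ S ∩ S', R t)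
    (hC : ∀ W : Finset P, IsUpperSet (W : Set P) →
      ∑ t ∈ W, R t + (∑ r, ν r) * (∑ r ∈ U, ν r) * ∑ s ∈ W ∩ Uᶜ, ν s
        ≤ (∑ r, ν r) * ((∑ r, ν r) + ∑ r ∈ Uᶜ, ν r) * ∑ t ∈ W ∩ U, ν t) :
    ∃ (R' : P → ℝ) (F : P → P → ℝ),
      (∀ t ∈ U, 0 ≤ R' t) ∧ (∀ t s, 0 ≤ F t s) ∧ (∀ t s, F t s ≠ 0 → s ≤ t) ∧
      (∀ t ∈ U, R' t + ∑ s ∈ Uᶜ, F t s ≤ (∑ r, ν r) * ((∑ r, ν r) + ∑ r ∈ Uᶜ, ν r) * ν t) ∧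
      (∀ s ∈ Uᶜ, (∑ r, ν r) * (∑ r ∈ U, ν r) * ν s ≤ ∑ t ∈ U, F t s) ∧
      (∀ S S' : Finset P, IsUpperSet (S : Set P) → IsUpperSet (S' : Set P) →
        (∑ r, ν r) * ((∑ t ∈ S, ν t) * (∑ t ∈ S' ∩ U, ν t) + (∑ t ∈ S', ν t) * (∑ t ∈ S ∩ U, ν t))
            - (∑ r ∈ U, ν r) * (∑ t ∈ S, ν t) * (∑ t ∈ S', ν t)
          ≤ ∑ t ∈ (S ∩ S') ∩ U, R' t
            + ∑ s ∈ (S ∩ S') ∩ Uᶜ, (∑ t ∈ U, F t s - (∑ r, ν r) * (∑ r ∈ U, ν r) * ν s)) := by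
  have hsplit0 : ∑ t, ν t = (∑ t ∈ U, ν t) + ∑ t ∈ Uᶜ, ν t := (Finset.sum_add_sum_compl U ν).symm
  have hZ0 : 0 ≤ ∑ t, ν t := Finset.sum_nonneg fun t _ => hν t
  have hNU0 : 0 ≤ ∑ t ∈ U, ν t := Finset.sum_nonneg fun t _ => hν t
  have hND0 : 0 ≤ ∑ t ∈ Uᶜ, ν t := Finset.sum_nonneg fun t _ => hν t
  obtain ⟨Z, hZ⟩ : ∃ x : ℝ, ∑ t, ν t = x := ⟨_, rfl⟩
  obtain ⟨NU, hNU⟩ : ∃ x : ℝ, ∑ t ∈ U, ν t = x := ⟨_, rfl⟩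
  obtain ⟨ND, hND⟩ : ∃ x : ℝ, ∑ t ∈ Uᶜ, ν t = x := ⟨_, rfl⟩
  rw [hZ, hNU, hND] at hsplit0
  rw [hZ] at hZ0; rw [hNU] at hNU0; rw [hND] at hND0
  simp only [hZ, hNU, hND] at hL hC ⊢
  have huniv : IsUpperSet ((univ : Finset P) : Set P) := by rw [Finset.coe_univ]; exact isUpperSet_univ
  -- total mass of `R`
  have hsumR : ∑ t, R t = Z * Z * NU := by
    have h1 := hL univ univ huniv huniv
    have h2 := hC univ huniv
    simp only [Finset.univ_inter, hZ, hNU, hND] at h1 h2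
    have e1 : Z * Z * NU ≤ ∑ t, R t := by nlinarith [h1]
    have e2 : ∑ t, R t ≤ Z * Z * NU := by nlinarith [h2]
    exact le_antisymm e2 e1
  -- the two weights
  set μ₁ : P → ℝ := fun y => R y + if y ∈ Uᶜ then Z * NU * ν y else 0 with hμ₁
  set μ₂ : P → ℝ := fun x => if x ∈ U then Z * (Z + ND) * ν x else 0 with hμ₂
  have hμ₁0 : ∀ y, 0 ≤ μ₁ y := fun y => by
    have := hν y
    simp only [hμ₁]; split_ifs
    · exact add_nonneg (hR y) (by positivity)
    · simpa using hR y
  have hμ₂0 : ∀ x, 0 ≤ μ₂ x := fun x => by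
    simp only [hμ₂]; split_ifs
    · have := hν x; positivity
    · exact le_rfl
  have sμ₁ : ∀ W : Finset P, ∑ y ∈ W, μ₁ y = ∑ y ∈ W, R y + Z * NU * ∑ s ∈ W ∩ Uᶜ, ν s := by
    intro W
    simp only [hμ₁]
    rw [Finset.sum_add_distrib, Finset.sum_ite_mem, ← Finset.mul_sum]
  have sμ₂ : ∀ W : Finset P, ∑ x ∈ W, μ₂ x = Z * (Z + ND) * ∑ t ∈ W ∩ U, ν t := by
    intro W
    simp only [hμ₂]
    rw [Finset.sum_ite_mem, ← Finset.mul_sum]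
  have hmass : ∑ y, μ₁ y = ∑ x, μ₂ x := by
    rw [sμ₁ univ, sμ₂ univ, Finset.univ_inter, Finset.univ_inter, hsumR, hND, hNU, hsplit0]
    ring
  have hdom : ∀ W : Finset P, IsUpperSet (W : Set P) → ∑ y ∈ W, μ₁ y ≤ ∑ x ∈ W, μ₂ x := by
    intro W hW
    rw [sμ₁ W, sμ₂ W]
    exact hC W hW
  obtain ⟨π, hπ0, hsupp, hm1, hm2⟩ := exists_monotoneCoupling_of_upperSets_le μ₁ μ₂ hμ₁0 hμ₂0 hmass hdom
  -- no mass arrives outside `U`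
  have hπU : ∀ y x, x ∉ U → π y x = 0 := by
    intro y x hx
    have h0 : ∑ y, π y x = 0 := by rw [hm2 x]; simp [hμ₂, hx]
    exact (Finset.sum_eq_zero_iff_of_nonneg fun y _ => hπ0 y x).1 h0 y (mem_univ y)
  -- deliveries to `s ∉ U`
  have hdel : ∀ s, s ∉ U → ∑ t ∈ U, (if s ∈ U then (0 : ℝ) else π s t) = R s + Z * NU * ν s := by
    intro s hs
    simp only [hs, ↓reduceIte]
    have e : ∑ t ∈ U, π s t = ∑ t, π s t :=
      Finset.sum_subset (Finset.subset_univ U) fun t _ ht => hπU s t ht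
    rw [e, hm1 s]
    simp [hμ₁, hs]
  refine ⟨fun x => ∑ y ∈ U, π y x, fun t s => if s ∈ U then 0 else π s t, ?_, ?_, ?_, ?_, ?_, ?_⟩
  · -- (R0)
    intro t _; exact Finset.sum_nonneg fun y _ => hπ0 y t
  · -- (F0)
    intro t s; dsimp only; split_ifs
    · exact le_rfl
    · exact hπ0 s t
  · -- (F≤)
    intro t s h
    dsimp only at h
    by_cases hs : s ∈ U
    · simp [hs] at h
    · simp only [hs, ↓reduceIte] at h
      exact hsupp s t h
  · -- (cap), with equality
    intro t ht
    have e1 : ∑ s ∈ Uᶜ, (if s ∈ U then (0 : ℝ) else π s t) = ∑ s ∈ Uᶜ, π s t :=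
      Finset.sum_congr rfl fun s hs => by rw [Finset.mem_compl] at hs; simp [hs]
    rw [e1, Finset.sum_add_sum_compl U fun y => π y t, hm2 t]
    simp [hμ₂, ht]
  · -- (K)
    intro s hs
    rw [Finset.mem_compl] at hs
    rw [hdel s hs]
    linarith [hR s]
  · -- (pair)
    intro S S' hS hS'
    have hW : IsUpperSet ((S ∩ S' : Finset P) : Set P) := by rw [Finset.coe_inter]; exact hS.inter hS'
    set W := S ∩ S' with hWdef
    -- the `Uᶜ` part is `Σ_{W ∩ Uᶜ} R`
    have e2 : ∑ s ∈ W ∩ Uᶜ, (∑ t ∈ U, (if s ∈ U then (0 : ℝ) else π s t) - Z * NU * ν s) = ∑ s ∈ W ∩ Uᶜ, R s := by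
      refine Finset.sum_congr rfl fun s hs => ?_
      have hs' : s ∉ U := by rw [Finset.mem_inter, Finset.mem_compl] at hs; exact hs.2
      rw [hdel s hs']; ring
    -- the `U` part dominates `Σ_{W ∩ U} R`
    have e1 : ∑ y ∈ W ∩ U, R y ≤ ∑ x ∈ W ∩ U, ∑ y ∈ U, π y x := by
      have step1 : ∑ y ∈ W ∩ U, R y = ∑ y ∈ W ∩ U, ∑ x ∈ W ∩ U, π y x := by
        refine Finset.sum_congr rfl fun y hy => ?_
        have hyU : y ∈ U := (Finset.mem_inter.1 hy).2
        have hyW : y ∈ W := (Finset.mem_inter.1 hy).1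
        have hRy : R y = μ₁ y := by simp [hμ₁, hyU]
        rw [hRy, ← hm1 y]
        refine (Finset.sum_subset (Finset.subset_univ _) fun x _ hx => ?_).symm
        by_contra hne
        have hxU : x ∈ U := by by_contra hxU; exact hne (hπU y x hxU)
        have hxW : x ∈ W := hW (hsupp y x hne) (Finset.mem_coe.2 hyW)
        exact hx (Finset.mem_inter.2 ⟨hxW, hxU⟩)
      rw [step1, Finset.sum_comm]
      exact Finset.sum_le_sum fun x _ =>
        Finset.sum_le_sum_of_subset_of_nonneg Finset.inter_subset_right fun y _ _ => hπ0 y x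
    have hLW := hL S S' hS hS'
    rw [e2]
    have e3 : ∑ t ∈ W, R t = ∑ t ∈ W ∩ U, R t + ∑ t ∈ W ∩ Uᶜ, R t := sum_split W U R
    linarith [e1, e3, hLW]

/-- **Flow certificate ⟹ flow-free form** (the easy converse): from `(R, F)` with (R0), (F0), (F≤), (cap), (K), (pair) the
function `t ↦ R t` on `U`, `s ↦ Σ_{t∈U} F t s − Z·N_U·ν s` on `Uᶜ` is nonnegative and satisfies (L) and (C) — mass delivered
into an up-set comes from inside it. [this work] -/
theorem sandwich_of_certificate (U : Finset P) (ν R : P → ℝ) (F : P → P → ℝ)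
    (hR0 : ∀ t ∈ U, 0 ≤ R t) (hF0 : ∀ t s, 0 ≤ F t s) (hFle : ∀ t s, F t s ≠ 0 → s ≤ t)
    (hcap : ∀ t ∈ U, R t + ∑ s ∈ Uᶜ, F t s ≤ (∑ r, ν r) * ((∑ r, ν r) + ∑ r ∈ Uᶜ, ν r) * ν t)
    (hK : ∀ s ∈ Uᶜ, (∑ r, ν r) * (∑ r ∈ U, ν r) * ν s ≤ ∑ t ∈ U, F t s)
    (hpair : ∀ S S' : Finset P, IsUpperSet (S : Set P) → IsUpperSet (S' : Set P) →
      (∑ r, ν r) * ((∑ t ∈ S, ν t) * (∑ t ∈ S' ∩ U, ν t) + (∑ t ∈ S', ν t) * (∑ t ∈ S ∩ U, ν t))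
          - (∑ r ∈ U, ν r) * (∑ t ∈ S, ν t) * (∑ t ∈ S', ν t)
        ≤ ∑ t ∈ (S ∩ S') ∩ U, R t + ∑ s ∈ (S ∩ S') ∩ Uᶜ, (∑ t ∈ U, F t s - (∑ r, ν r) * (∑ r ∈ U, ν r) * ν s)) :
    ∃ R₁ : P → ℝ, (∀ t, 0 ≤ R₁ t) ∧
      (∀ S S' : Finset P, IsUpperSet (S : Set P) → IsUpperSet (S' : Set P) →
        (∑ r, ν r) * ((∑ t ∈ S, ν t) * (∑ t ∈ S' ∩ U, ν t) + (∑ t ∈ S', ν t) * (∑ t ∈ S ∩ U, ν t))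
            - (∑ r ∈ U, ν r) * (∑ t ∈ S, ν t) * (∑ t ∈ S', ν t) ≤ ∑ t ∈ S ∩ S', R₁ t) ∧
      (∀ W : Finset P, IsUpperSet (W : Set P) →
        ∑ t ∈ W, R₁ t + (∑ r, ν r) * (∑ r ∈ U, ν r) * ∑ s ∈ W ∩ Uᶜ, ν s
          ≤ (∑ r, ν r) * ((∑ r, ν r) + ∑ r ∈ Uᶜ, ν r) * ∑ t ∈ W ∩ U, ν t) := by
  obtain ⟨Z, hZ⟩ : ∃ x : ℝ, ∑ t, ν t = x := ⟨_, rfl⟩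
  obtain ⟨NU, hNU⟩ : ∃ x : ℝ, ∑ t ∈ U, ν t = x := ⟨_, rfl⟩
  obtain ⟨ND, hND⟩ : ∃ x : ℝ, ∑ t ∈ Uᶜ, ν t = x := ⟨_, rfl⟩
  simp only [hZ, hNU, hND] at hcap hK hpair ⊢
  refine ⟨fun t => if t ∈ U then R t else ∑ t' ∈ U, F t' t - Z * NU * ν t, ?_, ?_, ?_⟩
  · intro t
    dsimp only; split_ifs with ht
    · exact hR0 t ht
    · exact sub_nonneg.2 (hK t (Finset.mem_compl.2 ht))
  · intro S S' hS hS'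
    have e : ∑ t ∈ S ∩ S', (if t ∈ U then R t else ∑ t' ∈ U, F t' t - Z * NU * ν t) =
        ∑ t ∈ (S ∩ S') ∩ U, R t + ∑ s ∈ (S ∩ S') ∩ Uᶜ, (∑ t ∈ U, F t s - Z * NU * ν s) := by
      rw [sum_split (S ∩ S') U]
      congr 1
      · exact Finset.sum_congr rfl fun t ht => by rw [if_pos (Finset.mem_inter.1 ht).2]
      · exact Finset.sum_congr rfl fun t ht => by
          rw [if_neg (Finset.mem_compl.1 (Finset.mem_inter.1 ht).2)]
    rw [e]; exact hpair S S' hS hS'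
  · intro W hW
    have e : ∑ t ∈ W, (if t ∈ U then R t else ∑ t' ∈ U, F t' t - Z * NU * ν t) =
        ∑ t ∈ W ∩ U, R t + ∑ s ∈ W ∩ Uᶜ, (∑ t ∈ U, F t s - Z * NU * ν s) := by
      rw [sum_split W U]
      congr 1
      · exact Finset.sum_congr rfl fun t ht => by rw [if_pos (Finset.mem_inter.1 ht).2]
      · exact Finset.sum_congr rfl fun t ht => by
          rw [if_neg (Finset.mem_compl.1 (Finset.mem_inter.1 ht).2)]
    rw [e, Finset.sum_sub_distrib, ← Finset.mul_sum]
    -- flows into `W ∩ Uᶜ` start in `W ∩ U`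
    have hin : ∑ s ∈ W ∩ Uᶜ, ∑ t ∈ U, F t s = ∑ s ∈ W ∩ Uᶜ, ∑ t ∈ W ∩ U, F t s := by
      refine Finset.sum_congr rfl fun s hs => ?_
      have hsW : s ∈ W := (Finset.mem_inter.1 hs).1
      refine (Finset.sum_subset Finset.inter_subset_right fun t htU ht => ?_).symm
      by_contra hne
      exact ht (Finset.mem_inter.2 ⟨hW (hFle t s hne) (Finset.mem_coe.2 hsW), htU⟩)
    have hle : ∑ s ∈ W ∩ Uᶜ, ∑ t ∈ W ∩ U, F t s ≤ ∑ t ∈ W ∩ U, ∑ s ∈ Uᶜ, F t s := by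
      rw [Finset.sum_comm]
      exact Finset.sum_le_sum fun t _ =>
        Finset.sum_le_sum_of_subset_of_nonneg Finset.inter_subset_right fun s _ _ => hF0 t s
    have hcapW : ∑ t ∈ W ∩ U, (R t + ∑ s ∈ Uᶜ, F t s) ≤ ∑ t ∈ W ∩ U, Z * (Z + ND) * ν t :=
      Finset.sum_le_sum fun t ht => hcap t (Finset.mem_inter.1 ht).2
    rw [Finset.sum_add_distrib, ← Finset.mul_sum] at hcapW
    linarith [hin, hle, hcapW]

/-- **Sahi's cubic `Z³E₃ ≥ 0` from the flow-free form.**  With the data of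
`…SahiE3PatternCertificate.phi_nonneg_of_patternCertificate` (`ν ≥ 0`, `α, β ≥ 0` monotone, `γ` monotone, `γ ≥ αβ`) and an
`R ≥ 0` on `P` satisfying (L) and (C), Sahi's functional for the triple (`U`-fibres, `A`, `B`) in fibre data is nonnegative. [this work] -/
theorem phi_nonneg_of_sandwich (U : Finset P) (ν α β γ R : P → ℝ) (hν : ∀ t, 0 ≤ ν t)
    (hα0 : ∀ t, 0 ≤ α t) (hα : Monotone α) (hβ0 : ∀ t, 0 ≤ β t) (hβ : Monotone β)
    (hγ : Monotone γ) (hγf : ∀ t, α t * β t ≤ γ t) (hR : ∀ t, 0 ≤ R t)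
    (hL : ∀ S S' : Finset P, IsUpperSet (S : Set P) → IsUpperSet (S' : Set P) →
      (∑ r, ν r) * ((∑ t ∈ S, ν t) * (∑ t ∈ S' ∩ U, ν t) + (∑ t ∈ S', ν t) * (∑ t ∈ S ∩ U, ν t))
          - (∑ r ∈ U, ν r) * (∑ t ∈ S, ν t) * (∑ t ∈ S', ν t) ≤ ∑ t ∈ S ∩ S', R t)
    (hC : ∀ W : Finset P, IsUpperSet (W : Set P) →
      ∑ t ∈ W, R t + (∑ r, ν r) * (∑ r ∈ U, ν r) * ∑ s ∈ W ∩ Uᶜ, ν s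
        ≤ (∑ r, ν r) * ((∑ r, ν r) + ∑ r ∈ Uᶜ, ν r) * ∑ t ∈ W ∩ U, ν t) :
    0 ≤ 2 * (∑ t, ν t) ^ 2 * (∑ t ∈ U, ν t * γ t)
        + (∑ t ∈ U, ν t) * (∑ t, ν t * α t) * (∑ t, ν t * β t)
        - (∑ t, ν t) * ((∑ t ∈ U, ν t) * (∑ t, ν t * γ t) + (∑ t, ν t * α t) * (∑ t ∈ U, ν t * β t)
            + (∑ t, ν t * β t) * (∑ t ∈ U, ν t * α t)) := by
  obtain ⟨R', F, hR0, hF0, hFle, hcap, hK, hpair⟩ := exists_certificate_of_sandwich U ν R hν hR hL hC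
  exact SahiE3PatternCertificate.phi_nonneg_of_patternCertificate U ν α β γ R' F hα0 hα hβ0 hβ hγ hγf
    hR0 hF0 hFle hcap hK hpair

section Lattice

open Literature.Probability.LatticeModels SahiE3HitSlotCertificate

variable {α : Type*} [DistribLattice α] [Fintype α] [DecidableEq α] [DecidableLE α]
variable {ι : Type*} [Fintype ι] [DecidableEq ι]

open scoped Classical in
/-- **FKG slot-locality for a junta pattern from the flow-free form.**  `μ ≥ 0` log-supermodular on a finite distributive
lattice, `j : ι → α` join-primes with pattern fibres `F_t` (`hF`), `ν_t = m(F_t)`, `A, B` up-sets, `U'` any set of patterns and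
`U` its preimage slot.  An `R ≥ 0` on the pattern cube with (L) and (C) gives `0 ≤ latticeE3 μ U A B`. [this work] -/
theorem latticeE3_nonneg_of_sandwich {μ : α → ℝ} (hμ₀ : 0 ≤ μ)
    (hμ : ∀ a b, μ a * μ b ≤ μ (a ⊓ b) * μ (a ⊔ b)) {j : ι → α} (hj : ∀ i, SupPrime (j i))
    {F : (ι → Bool) → Finset α} (hF : ∀ (t : ι → Bool) (x : α), x ∈ F t ↔ ∀ i, (j i ≤ x ↔ t i = true))
    {A B : Finset α} (hA : IsUpperSet (A : Set α)) (hB : IsUpperSet (B : Set α)) (U' : Finset (ι → Bool))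
    (ν : (ι → Bool) → ℝ) (hν : ∀ t, ν t = mass μ (F t)) (R : (ι → Bool) → ℝ) (hR : ∀ t, 0 ≤ R t)
    (hL : ∀ S S' : Finset (ι → Bool), IsUpperSet (S : Set (ι → Bool)) → IsUpperSet (S' : Set (ι → Bool)) →
      (∑ r, ν r) * ((∑ t ∈ S, ν t) * (∑ t ∈ S' ∩ U', ν t) + (∑ t ∈ S', ν t) * (∑ t ∈ S ∩ U', ν t))
          - (∑ r ∈ U', ν r) * (∑ t ∈ S, ν t) * (∑ t ∈ S', ν t) ≤ ∑ t ∈ S ∩ S', R t)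
    (hC : ∀ W : Finset (ι → Bool), IsUpperSet (W : Set (ι → Bool)) →
      ∑ t ∈ W, R t + (∑ r, ν r) * (∑ r ∈ U', ν r) * ∑ s ∈ W ∩ U'ᶜ, ν s
        ≤ (∑ r, ν r) * ((∑ r, ν r) + ∑ r ∈ U'ᶜ, ν r) * ∑ t ∈ W ∩ U', ν t) :
    0 ≤ latticeE3 μ (univ.filter fun x => (fun i => decide (j i ≤ x)) ∈ U') A B := by
  have hν0 : ∀ t, 0 ≤ ν t := fun t => by rw [hν]; exact mass_nonneg hμ₀ _
  obtain ⟨R', Fl, hR0, hF0, hFle, hcap, hK, hpair⟩ := exists_certificate_of_sandwich U' ν R hν0 hR hL hC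
  exact SahiE3PatternCertificate.latticeE3_nonneg_of_patternCertificate hμ₀ hμ hj hF hA hB U' ν hν R' Fl
    hR0 hF0 hFle hcap hK hpair

end Lattice

end Summit.CriticalPhenomena.PercolationContinuityZ3.Theorems.SahiE3CertSandwich
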